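import Literature.LinearAlgebra.PauliDeterminantSeveralCubes
import Literature.Probability.LatticeModels.ScaledKernelCubeDecay
import Literature.MathematicalPhysics.QuantumLattice.GrassmannGaussianMoments
import HarnessLib

/-!
# Magnen–Rivasseau–Sénéor (CMP 155, 1993) p.354 tl.13–15: «their functional integration gives a determinant which
# can be evaluated without any factorial effect» — the finite-dimensional kernel statement

Cell `pub-balaban-gaps` (G3), seat mrs-lit-2 (gen 15, file 38).  CMP 155 p.354 tl.13–15 prints, about the
Faddeev–Popov ghosts of the small-field expansion: «By Pauli principle, low momentum ghosts fields are dominable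
[R]; their functional integration gives a determinant which can be evaluated without any factorial effect.»  The
two halves of that sentence are, at the finite-dimensional level, two kernel theorems of the tree, and THIS file
puts them together:

* «their functional integration gives a determinant» — the fermionic Wick rule for a Gaussian Berezin integral,
  `QuantumLattice.grassmannGaussian_wick`: `⟨∏ₐ ψ̄_{iₐ} ψ_{jₐ}⟩_Q = det [(Q⁻¹)_{jₐ i_b}]_{a,b}` (Mastropietro 2008
  (2.30));
* «which can be evaluated without any factorial effect» — [R] Lemma III.4.1 (III.4.9) in its printed shape on the
  lattice of cubes, `PauliDeterminant.abs_det_mul_prod_factorial_pow_le_zlattice` (file 37): if the covariance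
  `(Q⁻¹)_{uv} = C^{α_u α_v}(x_u, x_v)` comes from a kernel whose sections have `2d(2r+1)` derivatives bounded by
  `Kℓ^{−n}(1 + |Δ − Δ'|_∞)^{−s}` between the cubes of side `ℓ` containing the points (`s > d`; the shape of
  [R] (III.4.8)), then for every positive integer `r`
  `|⟨∏ₐ ψ̄_{iₐ} ψ_{jₐ}⟩_Q| · ∏_Δ (n_Δ!)^r (n̄_Δ!)^r ≤ K(r)^n`,
  `n_Δ` / `n̄_Δ` = the number of `ψ` / `ψ̄` fields sitting in the cube `Δ`, with
  `K(r) = 4pK(2ζ_{s/d})^d(2^{d+1}·#A·D)^{2r+1}`, `p = 2d(2r+1)`, `D = Σ_{m<p} d^m`, uniform in the finite set of cubes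
  and in `n` — `abs_wick_mul_prod_factorial_pow_le`;
* the same with DATA-ONLY hypotheses — `abs_wick_mul_prod_factorial_pow_le_of_profile`: the covariance is a dilated
  profile `(Q⁻¹)_{uv} = λ^a F^{idx u, idx v}(λ(pos u − pos v))` whose derivatives decay like `B(1+‖w‖)^{−s}`, the
  cubes have side `λ⁻¹`, and the (III.4.8)-shaped bounds are DISCHARGED by `ScaledKernelCubeDecay.lean`
  (`K = 2^s B λ^a`); and `abs_wick_mul_prod_factorial_pow_le_of_exp_profile`: derivatives decaying like
  `B e^{−c‖w‖}` — the EXPONENTIAL shape actually printed in (III.4.8) — via `ScaledKernel.exp_profile_bound`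
  (`s = d + 1`, `B' = B(d+1)!e^c/c^{d+1}`).

HONEST FRAMING: finite-dimensional Grassmann algebra (finitely many ghost modes `κ`, an invertible quadratic form
`Q`) and finite linear algebra ∕ calculus.  The derivative-and-decay bounds on the ghost covariance are HYPOTHESES:
nothing is proved here about MRS's actual ghost propagator in the background field (Sect. II.D–F), about the
large ∕ small field split, «dominable», the cluster expansion or any limit; MRS work at a FIXED INFRARED CUTOFF;
nothing continuum, nothing `T⁴`-global, no mass gap, nothing Clay.  No definition, no named fact (D-0026 net debt 0);
eight theorems (three at the determinant level with the exponential cube weight, five at the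
Berezin ∕ Wick level) + one private helper.

## References

* [MagnenRivasseauSeneor1993] J. Magnen, V. Rivasseau, R. Sénéor, *Construction of YM₄ with an infrared cutoff*,
  Commun. Math. Phys. 155 (1993) 325–383, p.354 tl.13–15 (held scan `paper:magnen1993-cmp155-mrs-ym4-infrared-cutoff`,
  PDF p.30).
* [Rivasseau1991] V. Rivasseau, *From Perturbative to Constructive Renormalization*, Princeton 1991, §III.4
  Lemma III.4.1 (III.4.9) p.245 L21–L26 and its proof p.246 L1–L27; §III.1 (III.1.6) p.149.
* [Mastropietro2008] V. Mastropietro, *Non-Perturbative Renormalization*, World Scientific 2008, Ch. 2 (2.12),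
  (2.30) (the fermionic Wick rule; cited through the tree's `GrassmannGaussianMoments.lean`).
-/

namespace Literature.MathematicalPhysics.QuantumFieldTheory.MagnenRivasseauSeneor1993

namespace GhostDeterminant

open Finset Matrix Set Literature.MathematicalPhysics.QuantumLattice
open Literature.MathematicalPhysics.QuantumLattice.GrassmannAlgebra
open Literature.Probability.LatticeModels.VolumeEffect.ZLattice (supDist)
open Literature.Probability.LatticeModels.PolymerTreeSum.ZLattice (T1)
open Literature.LinearAlgebra.PauliDeterminant
open Literature.Probability.LatticeModels.ScaledKernel
open scoped FourierTransform

/-! ### Determinant level: Lemma III.4.1 on `ℤ^d·ℓ` with the EXPONENTIAL cube weight of (III.4.8) (file 37՚s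
`abs_det_mul_sqrt_prod_factorial_pow_le_pi` with `dec = e^{−c|Δ−Δ'|_∞}`, row sums by `ScaledKernel.sum_exp_neg_mul_supDist_le`) -/

section ExpWeightsDet

variable {ι : Type*} [Fintype ι] [DecidableEq ι] [LinearOrder ι]

/-- The sup-distance between cube labels is symmetric. [folklore] -/
private theorem supDist_symm'' (d : ℕ) (u w : Fin d → ℤ) : supDist d u w = supDist d w u := by
  unfold supDist
  congr 2
  funext k
  rw [← Int.natAbs_neg, neg_sub]

/-- **Lemma III.4.1 on the lattice of cubes `ℤ^d·ℓ` with the EXPONENTIAL cube weight of (III.4.8)** —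
«`|∂^m C^i(x,y)| ≤ K·M^{i(m+1)} e^{−cM^i|x−y|}`» read between cubes: if the sections of the kernel `C^{αβ}(x,y)` have
`‖Dⁿ C^{α b_k}(·,y_k)(t)‖ ≤ K ℓ^{−n} e^{−c|Δ − Δ'_k|_∞}` for `t` in the cube `Δ` (`n ≤ 2dr`, `c > 0`) and symmetrically
for the columns, then `|det C^{a_j b_k}(x_j,y_k)| · √(∏_{Δ∈Λ} (n_Δ! n̄_Δ!)^{r−1}) ≤ (4pK·B₀·(2^{d+1}·#A·D)^r)^N` with
`B₀ = (2/(1 − e^{−c/d}))^d` (the row sums of the weight, `ScaledKernel.sum_exp_neg_mul_supDist_le`), `p = 2dr`,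
uniformly in the finite `Λ ⊂ ℤ^d`. [cite: Rivasseau1991, §III.4 Lemma III.4.1 (III.4.8)–(III.4.9) p.245, proof p.246 L1–L27] -/
theorem abs_det_mul_sqrt_prod_factorial_pow_le_zlattice_exp {A : Type*} [Fintype A] (d r : ℕ) (hd : 1 ≤ d)
    (hr : 1 ≤ r) {c ℓ K : ℝ} (hc : 0 < c) (hℓ : 0 < ℓ) (hK : 0 ≤ K) (Λ : Finset (Fin d → ℤ))
    (cr cc : ι → (Fin d → ℤ)) (hcr : ∀ j, cr j ∈ Λ) (hcc : ∀ k, cc k ∈ Λ) (x y : ι → Fin d → ℝ)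
    (hx : ∀ j μ, x j μ ∈ Icc (ℓ * (cr j μ : ℝ)) (ℓ * (cr j μ : ℝ) + ℓ))
    (hy : ∀ k μ, y k μ ∈ Icc (ℓ * (cc k μ : ℝ)) (ℓ * (cc k μ : ℝ) + ℓ))
    (a b : ι → A) (Cker : A → A → (Fin d → ℝ) → (Fin d → ℝ) → ℝ)
    (hgx : ∀ k α, ContDiff ℝ (2 * d * r) (fun t => Cker α (b k) t (y k)))
    (hgy : ∀ j β, ContDiff ℝ (2 * d * r) (fun t => Cker (a j) β (x j) t))
    (hKx : ∀ k α (n : ℕ), n ≤ 2 * d * r → ∀ Δ ∈ Λ, ∀ t : Fin d → ℝ,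
      (∀ μ, t μ ∈ Icc (ℓ * (Δ μ : ℝ)) (ℓ * (Δ μ : ℝ) + ℓ)) →
        ‖iteratedFDeriv ℝ n (fun t => Cker α (b k) t (y k)) t‖ ≤
          K * ℓ⁻¹ ^ n * Real.exp (-(c * supDist d Δ (cc k))))
    (hKy : ∀ j β (n : ℕ), n ≤ 2 * d * r → ∀ Δ ∈ Λ, ∀ t : Fin d → ℝ,
      (∀ μ, t μ ∈ Icc (ℓ * (Δ μ : ℝ)) (ℓ * (Δ μ : ℝ) + ℓ)) →
        ‖iteratedFDeriv ℝ n (fun t => Cker (a j) β (x j) t) t‖ ≤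
          K * ℓ⁻¹ ^ n * Real.exp (-(c * supDist d Δ (cr j)))) :
    |Matrix.det (Matrix.of fun j k => Cker (a j) (b k) (x j) (y k))| *
        Real.sqrt (∏ Δ ∈ Λ, (((((univ.filter fun j => cr j = Δ).card.factorial : ℕ) : ℝ)) *
          (((univ.filter fun k => cc k = Δ).card.factorial : ℕ) : ℝ)) ^ (r - 1)) ≤
      (4 * (2 * d * r) * K * (2 / (1 - Real.exp (-(c / d)))) ^ d *
          (2 ^ (d + 1) * (Fintype.card A * ∑ n ∈ Finset.range (2 * d * r), (d : ℝ) ^ n)) ^ r) ^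
        Fintype.card ι := by
  have hd0 : 0 < d := hd
  exact abs_det_mul_sqrt_prod_factorial_pow_le_pi d r hd hr hℓ hK Λ (fun Δ μ => ℓ * (Δ μ : ℝ)) cr cc hcr hcc
    x y hx hy (fun Δ Δ' => Real.exp (-(c * supDist d Δ Δ')))
    (fun Δ Δ' => (Real.exp_pos _).le)
    (fun Δ Δ' => by rw [supDist_symm'' d Δ Δ']) (fun Δ _ => sum_exp_neg_mul_supDist_le hd0 hc Δ Λ) a b Cker
    hgx hgy hKx hKy

/-- **The PRINTED SHAPE of (III.4.9) with the printed EXPONENTIAL decay (III.4.8)**: for every positive integer `r`,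
from `2d(2r+1)` derivatives bounded by `K ℓ^{−n} e^{−c|Δ − Δ'|_∞}` between the cubes,
`|det C^{a_j b_k}(x_j,y_k)| · ∏_{Δ∈Λ} (n_Δ!)^r (n̄_Δ!)^r ≤ (4pK(2/(1−e^{−c/d}))^d(2^{d+1}·#A·D)^{2r+1})^N`, `p = 2d(2r+1)`,
uniformly in `Λ` and `N`. [cite: Rivasseau1991, §III.4 Lemma III.4.1 (III.4.8)–(III.4.9) p.245 L9–L26, proof p.246 L1–L27] -/
theorem abs_det_mul_prod_factorial_pow_le_zlattice_exp {A : Type*} [Fintype A] (d r : ℕ) (hd : 1 ≤ d)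
    {c ℓ K : ℝ} (hc : 0 < c) (hℓ : 0 < ℓ) (hK : 0 ≤ K) (Λ : Finset (Fin d → ℤ))
    (cr cc : ι → (Fin d → ℤ)) (hcr : ∀ j, cr j ∈ Λ) (hcc : ∀ k, cc k ∈ Λ) (x y : ι → Fin d → ℝ)
    (hx : ∀ j μ, x j μ ∈ Icc (ℓ * (cr j μ : ℝ)) (ℓ * (cr j μ : ℝ) + ℓ))
    (hy : ∀ k μ, y k μ ∈ Icc (ℓ * (cc k μ : ℝ)) (ℓ * (cc k μ : ℝ) + ℓ))
    (a b : ι → A) (Cker : A → A → (Fin d → ℝ) → (Fin d → ℝ) → ℝ)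
    (hgx : ∀ k α, ContDiff ℝ (2 * d * (2 * r + 1)) (fun t => Cker α (b k) t (y k)))
    (hgy : ∀ j β, ContDiff ℝ (2 * d * (2 * r + 1)) (fun t => Cker (a j) β (x j) t))
    (hKx : ∀ k α (n : ℕ), n ≤ 2 * d * (2 * r + 1) → ∀ Δ ∈ Λ, ∀ t : Fin d → ℝ,
      (∀ μ, t μ ∈ Icc (ℓ * (Δ μ : ℝ)) (ℓ * (Δ μ : ℝ) + ℓ)) →
        ‖iteratedFDeriv ℝ n (fun t => Cker α (b k) t (y k)) t‖ ≤
          K * ℓ⁻¹ ^ n * Real.exp (-(c * supDist d Δ (cc k))))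
    (hKy : ∀ j β (n : ℕ), n ≤ 2 * d * (2 * r + 1) → ∀ Δ ∈ Λ, ∀ t : Fin d → ℝ,
      (∀ μ, t μ ∈ Icc (ℓ * (Δ μ : ℝ)) (ℓ * (Δ μ : ℝ) + ℓ)) →
        ‖iteratedFDeriv ℝ n (fun t => Cker (a j) β (x j) t) t‖ ≤
          K * ℓ⁻¹ ^ n * Real.exp (-(c * supDist d Δ (cr j)))) :
    |Matrix.det (Matrix.of fun j k => Cker (a j) (b k) (x j) (y k))| *
        ∏ Δ ∈ Λ, ((((univ.filter fun j => cr j = Δ).card.factorial : ℕ) : ℝ) ^ r *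
          (((univ.filter fun k => cc k = Δ).card.factorial : ℕ) : ℝ) ^ r) ≤
      (4 * (2 * d * (2 * r + 1)) * K * (2 / (1 - Real.exp (-(c / d)))) ^ d *
          (2 ^ (d + 1) * (Fintype.card A * ∑ n ∈ Finset.range (2 * d * (2 * r + 1)), (d : ℝ) ^ n)) ^
            (2 * r + 1)) ^ Fintype.card ι := by
  have h := abs_det_mul_sqrt_prod_factorial_pow_le_zlattice_exp d (2 * r + 1) hd (by omega) hc hℓ hK Λ cr cc hcr
    hcc x y hx hy a b Cker hgx hgy hKx hKy
  set nr : (Fin d → ℤ) → ℝ := fun Δ => ((((univ.filter fun j => cr j = Δ).card.factorial : ℕ) : ℝ)) with hnr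
  set nc : (Fin d → ℤ) → ℝ := fun Δ => ((((univ.filter fun k => cc k = Δ).card.factorial : ℕ) : ℝ)) with hnc
  have h1 : ∏ Δ ∈ Λ, (nr Δ * nc Δ) ^ (2 * r + 1 - 1) = (∏ Δ ∈ Λ, (nr Δ ^ r * nc Δ ^ r)) ^ 2 := by
    rw [← Finset.prod_pow]
    refine Finset.prod_congr rfl fun Δ _ => ?_
    rw [show 2 * r + 1 - 1 = r * 2 by omega, pow_mul, mul_pow]
  rw [h1, Real.sqrt_sq (Finset.prod_nonneg fun Δ _ => by positivity)] at h
  push_cast at h ⊢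
  exact h

/-- **Data-only form with the printed exponential decay**: for a kernel obtained by DILATION of profiles,
`C^{αβ}(x,y) = λ^a F^{αβ}(λ(x − y))` with `‖DⁿF^{αβ}(w)‖ ≤ B e^{−c‖w‖}` (`n ≤ p = 2d(2r+1)`, `c > 0`), cubes of side
`λ⁻¹`, the printed shape holds with `K = e^c B λ^a` (the (III.4.8)-shaped hypotheses being DISCHARGED by
`ScaledKernelCubeDecay.norm_iteratedFDeriv_dilate_le_cubes_exp`):
`|det C^{a_j b_k}(x_j,y_k)| · ∏_Δ (n_Δ!)^r (n̄_Δ!)^r ≤ (4p(e^c B λ^a)(2/(1−e^{−c/d}))^d(2^{d+1}·#A·D)^{2r+1})^N`.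
[cite: Rivasseau1991, §III.4 Lemma III.4.1 (III.4.8)–(III.4.9) p.245, proof p.246 L1–L27] -/
theorem abs_det_mul_prod_factorial_pow_le_of_exp_profile {A : Type*} [Fintype A] (d r : ℕ) (hd : 1 ≤ d)
    {c lam B : ℝ} (hc : 0 < c) (hlam : 0 < lam) (hB : 0 ≤ B) (a₀ : ℝ) (Λ : Finset (Fin d → ℤ))
    (cr cc : ι → (Fin d → ℤ)) (hcr : ∀ j, cr j ∈ Λ) (hcc : ∀ k, cc k ∈ Λ) (x y : ι → Fin d → ℝ)
    (hx : ∀ j μ, x j μ ∈ Icc (lam⁻¹ * (cr j μ : ℝ)) (lam⁻¹ * (cr j μ : ℝ) + lam⁻¹))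
    (hy : ∀ k μ, y k μ ∈ Icc (lam⁻¹ * (cc k μ : ℝ)) (lam⁻¹ * (cc k μ : ℝ) + lam⁻¹))
    (a b : ι → A) (F : A → A → (Fin d → ℝ) → ℝ) (hF : ∀ α β, ContDiff ℝ (2 * d * (2 * r + 1)) (F α β))
    (hFB : ∀ α β (n : ℕ), n ≤ 2 * d * (2 * r + 1) → ∀ w,
      ‖iteratedFDeriv ℝ n (F α β) w‖ ≤ B * Real.exp (-(c * ‖w‖))) :
    |Matrix.det (Matrix.of fun j k => lam ^ a₀ * F (a j) (b k) (lam • (x j - y k)))| *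
        ∏ Δ ∈ Λ, ((((univ.filter fun j => cr j = Δ).card.factorial : ℕ) : ℝ) ^ r *
          (((univ.filter fun k => cc k = Δ).card.factorial : ℕ) : ℝ) ^ r) ≤
      (4 * (2 * d * (2 * r + 1)) * (Real.exp c * B * lam ^ a₀) * (2 / (1 - Real.exp (-(c / d)))) ^ d *
          (2 ^ (d + 1) * (Fintype.card A * ∑ n ∈ Finset.range (2 * d * (2 * r + 1)), (d : ℝ) ^ n)) ^
            (2 * r + 1)) ^ Fintype.card ι := by
  have hℓ : 0 < lam⁻¹ := inv_pos.2 hlam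
  have hll : lam⁻¹⁻¹ = lam := inv_inv lam
  refine abs_det_mul_prod_factorial_pow_le_zlattice_exp d r hd hc hℓ (by positivity) Λ cr cc hcr hcc x y hx hy
    a b (fun α β x y => lam ^ a₀ * F α β (lam • (x - y))) ?_ ?_ ?_ ?_
  · intro k α
    exact contDiff_const.mul ((hF α (b k)).comp ((contDiff_id.sub contDiff_const).const_smul lam))
  · intro j β
    exact contDiff_const.mul ((hF (a j) β).comp ((contDiff_const.sub contDiff_id).const_smul lam))
  · intro k α m hm Δ hΔ t ht
    have h := norm_iteratedFDeriv_dilate_le_cubes_exp (F α (b k)) (hF α (b k)) hc.le hB (hFB α (b k)) hℓ a₀ Δ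
      (cc k) (hy k) hm ht
    rw [hll] at h
    calc ‖iteratedFDeriv ℝ m (fun t => lam ^ a₀ * F α (b k) (lam • (t - y k))) t‖
        ≤ Real.exp c * B * lam ^ a₀ * lam ^ m * Real.exp (-(c * supDist d Δ (cc k))) := h
      _ = Real.exp c * B * lam ^ a₀ * lam⁻¹⁻¹ ^ m * Real.exp (-(c * supDist d Δ (cc k))) := by rw [hll]
  · intro j β m hm Δ hΔ t ht
    have h := norm_iteratedFDeriv_dilate_le_cubes_exp' (F (a j) β) (hF (a j) β) hc.le hB (hFB (a j) β) hℓ a₀ Δ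
      (cr j) (hx j) hm ht
    rw [hll] at h
    calc ‖iteratedFDeriv ℝ m (fun t => lam ^ a₀ * F (a j) β (lam • (x j - t))) t‖
        ≤ Real.exp c * B * lam ^ a₀ * lam ^ m * Real.exp (-(c * supDist d Δ (cr j))) := h
      _ = Real.exp c * B * lam ^ a₀ * lam⁻¹⁻¹ ^ m * Real.exp (-(c * supDist d Δ (cr j))) := by rw [hll]

end ExpWeightsDet

/-- **«their functional integration gives a determinant which can be evaluated without any factorial effect»**
(CMP 155 p.354 tl.13–15), finite-dimensional kernel form.  Ghost modes `κ` (finitely many, linearly ordered) sit at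
points `pos u ∈ ℝ^d` in cubes `cube u ∈ Λ ⊂ ℤ^d` of side `ℓ` and carry an internal index `idx u ∈ A`; the Gaussian
Berezin integral has the invertible quadratic form `Q` with covariance `(Q⁻¹)_{uv} = C^{idx u, idx v}(pos u, pos v)`
for a kernel `C^{αβ}(x,y)` whose sections are `C^{2d(2r+1)}` with
`‖Dⁿ C^{αβ}(·,y)(t)‖, ‖Dⁿ C^{αβ}(x,·)(t)‖ ≤ K ℓ^{−n} (1 + |Δ − Δ'|_∞)^{−s}` for `t` in the cube `Δ` and the other
point in the cube `Δ'` (`n ≤ 2d(2r+1)`, `s > d`).  Then for any `2n` ghost fields `ψ̄_{i₁},…,ψ̄_{iₙ}, ψ_{j₁},…,ψ_{jₙ}`: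
`|⟨∏ₐ ψ̄_{iₐ}ψ_{jₐ}⟩_Q| · ∏_{Δ∈Λ} (n_Δ!)^r (n̄_Δ!)^r ≤ (4pK(2ζ_{s/d})^d(2^{d+1}·#A·D)^{2r+1})^n`
(`n_Δ = #{a : cube (jₐ) = Δ}`, `n̄_Δ = #{b : cube (i_b) = Δ}`, `p = 2d(2r+1)`, `D = Σ_{m<p} d^m`) — the Wick rule
(`grassmannGaussian_wick`) followed by [R] Lemma III.4.1 in its printed shape
(`PauliDeterminant.abs_det_mul_prod_factorial_pow_le_zlattice`).
[cite: MagnenRivasseauSeneor1993, p.354 tl.13–15] [cite: Rivasseau1991, §III.4 Lemma III.4.1 (III.4.9), pp.245–246] -/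
theorem abs_wick_mul_prod_factorial_pow_le {κ : Type*} [LinearOrder κ] [Fintype κ] {A : Type*} [Fintype A]
    (d r : ℕ) (hd : 1 ≤ d) {s ℓ K : ℝ} (hs : (d : ℝ) < s) (hℓ : 0 < ℓ) (hK : 0 ≤ K)
    (Λ : Finset (Fin d → ℤ)) (pos : κ → Fin d → ℝ) (cube : κ → Fin d → ℤ) (idx : κ → A)
    (hcube : ∀ u, cube u ∈ Λ)
    (hpos : ∀ u μ, pos u μ ∈ Icc (ℓ * (cube u μ : ℝ)) (ℓ * (cube u μ : ℝ) + ℓ))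
    (Cker : A → A → (Fin d → ℝ) → (Fin d → ℝ) → ℝ)
    (hC1 : ∀ α β (y : Fin d → ℝ), ContDiff ℝ (2 * d * (2 * r + 1)) (fun t => Cker α β t y))
    (hC2 : ∀ α β (x : Fin d → ℝ), ContDiff ℝ (2 * d * (2 * r + 1)) (fun t => Cker α β x t))
    (hK1 : ∀ α β (y : Fin d → ℝ) (n : ℕ), n ≤ 2 * d * (2 * r + 1) → ∀ Δ ∈ Λ, ∀ Δ' ∈ Λ,
      (∀ μ, y μ ∈ Icc (ℓ * (Δ' μ : ℝ)) (ℓ * (Δ' μ : ℝ) + ℓ)) → ∀ t : Fin d → ℝ,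
        (∀ μ, t μ ∈ Icc (ℓ * (Δ μ : ℝ)) (ℓ * (Δ μ : ℝ) + ℓ)) →
          ‖iteratedFDeriv ℝ n (fun t => Cker α β t y) t‖ ≤ K * ℓ⁻¹ ^ n * (1 + supDist d Δ Δ') ^ (-s))
    (hK2 : ∀ α β (x : Fin d → ℝ) (n : ℕ), n ≤ 2 * d * (2 * r + 1) → ∀ Δ ∈ Λ, ∀ Δ' ∈ Λ,
      (∀ μ, x μ ∈ Icc (ℓ * (Δ' μ : ℝ)) (ℓ * (Δ' μ : ℝ) + ℓ)) → ∀ t : Fin d → ℝ,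
        (∀ μ, t μ ∈ Icc (ℓ * (Δ μ : ℝ)) (ℓ * (Δ μ : ℝ) + ℓ)) →
          ‖iteratedFDeriv ℝ n (fun t => Cker α β x t) t‖ ≤ K * ℓ⁻¹ ^ n * (1 + supDist d Δ Δ') ^ (-s))
    (Q : Matrix κ κ ℝ) (hQ : Q.det ≠ 0) (hG : ∀ u v, Q⁻¹ u v = Cker (idx u) (idx v) (pos u) (pos v))
    {n : ℕ} (i j : Fin n → κ) :
    |berezin ℝ (κ ⊕ₗ κ) (grassmannExp (quadratic ℝ Q) *
          (List.ofFn fun a => psiBar ℝ (i a) * psi ℝ (j a)).prod) /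
        berezin ℝ (κ ⊕ₗ κ) (grassmannExp (quadratic ℝ Q))| *
      ∏ Δ ∈ Λ, ((((univ.filter fun a : Fin n => cube (j a) = Δ).card.factorial : ℕ) : ℝ) ^ r *
        (((univ.filter fun b : Fin n => cube (i b) = Δ).card.factorial : ℕ) : ℝ) ^ r) ≤
      (4 * (2 * d * (2 * r + 1)) * K * (2 * T1 (s / d)) ^ d *
          (2 ^ (d + 1) * (Fintype.card A * ∑ m ∈ Finset.range (2 * d * (2 * r + 1)), (d : ℝ) ^ m)) ^
            (2 * r + 1)) ^ n := by
  rw [grassmannGaussian_wick ℝ Q hQ i j]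
  have hmat : (Matrix.of fun a b => Q⁻¹ (j a) (i b)) =
      Matrix.of fun a b => Cker (idx (j a)) (idx (i b)) (pos (j a)) (pos (i b)) := by
    ext a b
    simp only [Matrix.of_apply, hG]
  rw [hmat]
  have h := abs_det_mul_prod_factorial_pow_le_zlattice (ι := Fin n) d r hd hs hℓ hK Λ
    (fun a => cube (j a)) (fun b => cube (i b)) (fun a => hcube _) (fun b => hcube _)
    (fun a => pos (j a)) (fun b => pos (i b)) (fun a μ => hpos _ μ) (fun b μ => hpos _ μ)
    (fun a => idx (j a)) (fun b => idx (i b)) Cker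
    (fun k α => hC1 α (idx (i k)) (pos (i k))) (fun a β => hC2 (idx (j a)) β (pos (j a)))
    (fun k α m hm Δ hΔ t ht => hK1 α (idx (i k)) (pos (i k)) m hm Δ hΔ (cube (i k)) (hcube _)
      (fun μ => hpos _ μ) t ht)
    (fun a β m hm Δ hΔ t ht => hK2 (idx (j a)) β (pos (j a)) m hm Δ hΔ (cube (j a)) (hcube _)
      (fun μ => hpos _ μ) t ht)
  simpa only [Fintype.card_fin] using h

/-- **The same with DATA-ONLY hypotheses: a ghost covariance of one momentum slice.**  If the covariance is a
dilated profile, `(Q⁻¹)_{uv} = λ^a F^{idx u, idx v}(λ(pos u − pos v))` with `C^p` profiles (`p = 2d(2r+1)`) obeying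
`‖DⁿF^{αβ}(w)‖ ≤ B(1 + ‖w‖)^{−s}` (`n ≤ p`, `s > d`; e.g. Schwartz profiles, `ScaledKernel.schwartz_profile_bound`)
and the ghost modes sit in cubes of side `λ⁻¹` (the slice's boxes), then for every positive integer `r` and all
`2n` fields `|⟨∏ₐ ψ̄_{iₐ}ψ_{jₐ}⟩_Q| · ∏_Δ (n_Δ!)^r (n̄_Δ!)^r ≤ (4p(2^s B λ^a)(2ζ_{s/d})^d(2^{d+1}·#A·D)^{2r+1})^n`
— «a determinant which can be evaluated without any factorial effect», the (III.4.8)-shaped hypotheses being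
DISCHARGED by `ScaledKernelCubeDecay.lean`.
[cite: MagnenRivasseauSeneor1993, p.354 tl.13–15] [cite: Rivasseau1991, §III.4 (III.4.8)–(III.4.9), p.245] -/
theorem abs_wick_mul_prod_factorial_pow_le_of_profile {κ : Type*} [LinearOrder κ] [Fintype κ] {A : Type*}
    [Fintype A] (d r : ℕ) (hd : 1 ≤ d) {s lam B : ℝ} (hs : (d : ℝ) < s) (hlam : 0 < lam) (hB : 0 ≤ B) (a : ℝ)
    (Λ : Finset (Fin d → ℤ)) (pos : κ → Fin d → ℝ) (cube : κ → Fin d → ℤ) (idx : κ → A)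
    (hcube : ∀ u, cube u ∈ Λ)
    (hpos : ∀ u μ, pos u μ ∈ Icc (lam⁻¹ * (cube u μ : ℝ)) (lam⁻¹ * (cube u μ : ℝ) + lam⁻¹))
    (F : A → A → (Fin d → ℝ) → ℝ) (hF : ∀ α β, ContDiff ℝ (2 * d * (2 * r + 1)) (F α β))
    (hFB : ∀ α β (n : ℕ), n ≤ 2 * d * (2 * r + 1) → ∀ w, ‖iteratedFDeriv ℝ n (F α β) w‖ ≤ B * (1 + ‖w‖) ^ (-s))
    (Q : Matrix κ κ ℝ) (hQ : Q.det ≠ 0)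
    (hG : ∀ u v, Q⁻¹ u v = lam ^ a * F (idx u) (idx v) (lam • (pos u - pos v)))
    {n : ℕ} (i j : Fin n → κ) :
    |berezin ℝ (κ ⊕ₗ κ) (grassmannExp (quadratic ℝ Q) *
          (List.ofFn fun a => psiBar ℝ (i a) * psi ℝ (j a)).prod) /
        berezin ℝ (κ ⊕ₗ κ) (grassmannExp (quadratic ℝ Q))| *
      ∏ Δ ∈ Λ, ((((univ.filter fun a : Fin n => cube (j a) = Δ).card.factorial : ℕ) : ℝ) ^ r *
        (((univ.filter fun b : Fin n => cube (i b) = Δ).card.factorial : ℕ) : ℝ) ^ r) ≤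
      (4 * (2 * d * (2 * r + 1)) * ((2 : ℝ) ^ s * B * lam ^ a) * (2 * T1 (s / d)) ^ d *
          (2 ^ (d + 1) * (Fintype.card A * ∑ m ∈ Finset.range (2 * d * (2 * r + 1)), (d : ℝ) ^ m)) ^
            (2 * r + 1)) ^ n := by
  have hs0 : 0 ≤ s := le_trans (Nat.cast_nonneg d) hs.le
  have hℓ : 0 < lam⁻¹ := inv_pos.2 hlam
  have hll : lam⁻¹⁻¹ = lam := inv_inv lam
  -- the kernel C^{αβ}(x,y) = λ^a F^{αβ}(λ(x − y)) and its (III.4.8)-shaped bounds from `ScaledKernelCubeDecay`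
  refine abs_wick_mul_prod_factorial_pow_le d r hd hs hℓ (by positivity) Λ pos cube idx hcube hpos
    (fun α β x y => lam ^ a * F α β (lam • (x - y))) ?_ ?_ ?_ ?_ Q hQ (fun u v => hG u v) i j
  · intro α β y
    exact contDiff_const.mul ((hF α β).comp ((contDiff_id.sub contDiff_const).const_smul lam))
  · intro α β x
    exact contDiff_const.mul ((hF α β).comp ((contDiff_const.sub contDiff_id).const_smul lam))
  · intro α β y m hm Δ hΔ Δ' hΔ' hy t ht
    have h := norm_iteratedFDeriv_dilate_le_cubes (F α β) (hF α β) hs0 hB (hFB α β) hℓ a Δ Δ' hy hm ht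
    rw [hll] at h
    calc ‖iteratedFDeriv ℝ m (fun t => lam ^ a * F α β (lam • (t - y))) t‖
        ≤ (2 : ℝ) ^ s * B * lam ^ a * lam ^ m * (1 + supDist d Δ Δ') ^ (-s) := h
      _ = (2 : ℝ) ^ s * B * lam ^ a * lam⁻¹⁻¹ ^ m * (1 + supDist d Δ Δ') ^ (-s) := by rw [hll]
  · intro α β x m hm Δ hΔ Δ' hΔ' hx t ht
    have h := norm_iteratedFDeriv_dilate_le_cubes' (F α β) (hF α β) hs0 hB (hFB α β) hℓ a Δ Δ' hx hm ht
    rw [hll] at h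
    calc ‖iteratedFDeriv ℝ m (fun t => lam ^ a * F α β (lam • (x - t))) t‖
        ≤ (2 : ℝ) ^ s * B * lam ^ a * lam ^ m * (1 + supDist d Δ Δ') ^ (-s) := h
      _ = (2 : ℝ) ^ s * B * lam ^ a * lam⁻¹⁻¹ ^ m * (1 + supDist d Δ Δ') ^ (-s) := by rw [hll]

/-- **The same from the EXPONENTIAL decay printed in (III.4.8).**  If the profiles obey
`‖DⁿF^{αβ}(w)‖ ≤ B e^{−c‖w‖}` (`n ≤ p = 2d(2r+1)`, `c > 0`) — the shape «`|∂^m C^i(x,y)| ≤ K·M^{i(m+1)} e^{−cM^i|x−y|}`»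
of [R] (III.4.8) after dilation by `λ = M^i` — then, with `s = d + 1` and `B' = B·(d+1)!·e^c/c^{d+1}`
(`ScaledKernel.exp_profile_bound`), for every positive integer `r` and all `2n` ghost fields
`|⟨∏ₐ ψ̄_{iₐ}ψ_{jₐ}⟩_Q| · ∏_Δ (n_Δ!)^r (n̄_Δ!)^r ≤ (4p(2^{d+1} B' λ^a)(2ζ_{(d+1)/d})^d(2^{d+1}·#A·D)^{2r+1})^n`.
[cite: MagnenRivasseauSeneor1993, p.354 tl.13–15] [cite: Rivasseau1991, §III.4 (III.4.8)–(III.4.9), p.245] -/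
theorem abs_wick_mul_prod_factorial_pow_le_of_exp_profile {κ : Type*} [LinearOrder κ] [Fintype κ] {A : Type*}
    [Fintype A] (d r : ℕ) (hd : 1 ≤ d) {lam B c : ℝ} (hlam : 0 < lam) (hB : 0 ≤ B) (hc : 0 < c) (a : ℝ)
    (Λ : Finset (Fin d → ℤ)) (pos : κ → Fin d → ℝ) (cube : κ → Fin d → ℤ) (idx : κ → A)
    (hcube : ∀ u, cube u ∈ Λ)
    (hpos : ∀ u μ, pos u μ ∈ Icc (lam⁻¹ * (cube u μ : ℝ)) (lam⁻¹ * (cube u μ : ℝ) + lam⁻¹))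
    (F : A → A → (Fin d → ℝ) → ℝ) (hF : ∀ α β, ContDiff ℝ (2 * d * (2 * r + 1)) (F α β))
    (hFB : ∀ α β (n : ℕ), n ≤ 2 * d * (2 * r + 1) → ∀ w,
      ‖iteratedFDeriv ℝ n (F α β) w‖ ≤ B * Real.exp (-(c * ‖w‖)))
    (Q : Matrix κ κ ℝ) (hQ : Q.det ≠ 0)
    (hG : ∀ u v, Q⁻¹ u v = lam ^ a * F (idx u) (idx v) (lam • (pos u - pos v)))
    {n : ℕ} (i j : Fin n → κ) :
    |berezin ℝ (κ ⊕ₗ κ) (grassmannExp (quadratic ℝ Q) *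
          (List.ofFn fun a => psiBar ℝ (i a) * psi ℝ (j a)).prod) /
        berezin ℝ (κ ⊕ₗ κ) (grassmannExp (quadratic ℝ Q))| *
      ∏ Δ ∈ Λ, ((((univ.filter fun a : Fin n => cube (j a) = Δ).card.factorial : ℕ) : ℝ) ^ r *
        (((univ.filter fun b : Fin n => cube (i b) = Δ).card.factorial : ℕ) : ℝ) ^ r) ≤
      (4 * (2 * d * (2 * r + 1)) *
          ((2 : ℝ) ^ ((d + 1 : ℕ) : ℝ) * (B * (((d + 1).factorial : ℝ) * Real.exp c / c ^ (d + 1))) * lam ^ a) *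
          (2 * T1 (((d + 1 : ℕ) : ℝ) / d)) ^ d *
          (2 ^ (d + 1) * (Fintype.card A * ∑ m ∈ Finset.range (2 * d * (2 * r + 1)), (d : ℝ) ^ m)) ^
            (2 * r + 1)) ^ n := by
  have hs : (d : ℝ) < ((d + 1 : ℕ) : ℝ) := by exact_mod_cast Nat.lt_succ_self d
  have hB' : 0 ≤ B * (((d + 1).factorial : ℝ) * Real.exp c / c ^ (d + 1)) := by positivity
  exact abs_wick_mul_prod_factorial_pow_le_of_profile d r hd hs hlam hB' a Λ pos cube idx hcube hpos F hF
    (fun α β m hm w => exp_profile_bound (F α β) hB hc (hFB α β) (d + 1) m hm w) Q hQ hG i j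

/-! ### The printed EXPONENTIAL cube weight all the way -/

/-- **The same, with the EXPONENTIAL decay of (III.4.8) kept as the cube weight** (no power-law detour): profiles
with `‖DⁿF^{αβ}(w)‖ ≤ B e^{−c‖w‖}` (`n ≤ p = 2d(2r+1)`, `c > 0`), covariance `(Q⁻¹)_{uv} = λ^a F^{idx u,idx v}(λ(pos u − pos v))`,
ghost modes in cubes of side `λ⁻¹`; then for every positive integer `r` and all `2n` ghost fields
`|⟨∏ₐ ψ̄_{iₐ}ψ_{jₐ}⟩_Q| · ∏_Δ (n_Δ!)^r (n̄_Δ!)^r ≤ (4p(e^c B λ^a)(2/(1 − e^{−c/d}))^d(2^{d+1}·#A·D)^{2r+1})^n`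
(`GhostDeterminant.abs_det_mul_prod_factorial_pow_le_of_exp_profile`, this file).
[cite: MagnenRivasseauSeneor1993, p.354 tl.13–15] [cite: Rivasseau1991, §III.4 (III.4.8)–(III.4.9), p.245] -/
theorem abs_wick_mul_prod_factorial_pow_le_of_exp_profile_expWeight {κ : Type*} [LinearOrder κ] [Fintype κ]
    {A : Type*} [Fintype A] (d r : ℕ) (hd : 1 ≤ d) {lam B c : ℝ} (hlam : 0 < lam) (hB : 0 ≤ B) (hc : 0 < c)
    (a : ℝ) (Λ : Finset (Fin d → ℤ)) (pos : κ → Fin d → ℝ) (cube : κ → Fin d → ℤ) (idx : κ → A)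
    (hcube : ∀ u, cube u ∈ Λ)
    (hpos : ∀ u μ, pos u μ ∈ Icc (lam⁻¹ * (cube u μ : ℝ)) (lam⁻¹ * (cube u μ : ℝ) + lam⁻¹))
    (F : A → A → (Fin d → ℝ) → ℝ) (hF : ∀ α β, ContDiff ℝ (2 * d * (2 * r + 1)) (F α β))
    (hFB : ∀ α β (n : ℕ), n ≤ 2 * d * (2 * r + 1) → ∀ w,
      ‖iteratedFDeriv ℝ n (F α β) w‖ ≤ B * Real.exp (-(c * ‖w‖)))
    (Q : Matrix κ κ ℝ) (hQ : Q.det ≠ 0)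
    (hG : ∀ u v, Q⁻¹ u v = lam ^ a * F (idx u) (idx v) (lam • (pos u - pos v)))
    {n : ℕ} (i j : Fin n → κ) :
    |berezin ℝ (κ ⊕ₗ κ) (grassmannExp (quadratic ℝ Q) *
          (List.ofFn fun a => psiBar ℝ (i a) * psi ℝ (j a)).prod) /
        berezin ℝ (κ ⊕ₗ κ) (grassmannExp (quadratic ℝ Q))| *
      ∏ Δ ∈ Λ, ((((univ.filter fun a : Fin n => cube (j a) = Δ).card.factorial : ℕ) : ℝ) ^ r *
        (((univ.filter fun b : Fin n => cube (i b) = Δ).card.factorial : ℕ) : ℝ) ^ r) ≤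
      (4 * (2 * d * (2 * r + 1)) * (Real.exp c * B * lam ^ a) * (2 / (1 - Real.exp (-(c / d)))) ^ d *
          (2 ^ (d + 1) * (Fintype.card A * ∑ m ∈ Finset.range (2 * d * (2 * r + 1)), (d : ℝ) ^ m)) ^
            (2 * r + 1)) ^ n := by
  rw [grassmannGaussian_wick ℝ Q hQ i j]
  have hmat : (Matrix.of fun a b => Q⁻¹ (j a) (i b)) =
      Matrix.of fun a' b' => lam ^ a * F (idx (j a')) (idx (i b')) (lam • (pos (j a') - pos (i b'))) := by
    ext a' b'
    simp only [Matrix.of_apply, hG]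
  rw [hmat]
  have h := abs_det_mul_prod_factorial_pow_le_of_exp_profile (ι := Fin n) d r hd hc hlam hB a Λ
    (fun a' => cube (j a')) (fun b' => cube (i b')) (fun a' => hcube _) (fun b' => hcube _)
    (fun a' => pos (j a')) (fun b' => pos (i b')) (fun a' μ => hpos _ μ) (fun b' μ => hpos _ μ)
    (fun a' => idx (j a')) (fun b' => idx (i b')) F hF hFB
  simpa only [Fintype.card_fin] using h

/-! ### «there exists a constant K(r)» — the printed quantifier shape, for the dilated-Schwartz-cutoff model -/

/-- **«For any positive integer r there exists a constant K(r) …» for ghost covariances built from Schwartz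
momentum cutoffs.**  Fix the dimension `d ≥ 1`, the internal index set `A`, a family of Schwartz momentum
profiles `φ^{αβ} ∈ 𝓢(ℝ^d, ℂ)` (Euclidean `ℝ^d`), a scale `λ > 0` and an exponent `a`.  Then for every positive
integer `r` there is a constant `K` such that for EVERY finite set of cubes `Λ ⊂ ℤ^d`, every finite family of ghost
modes sitting in cubes of side `λ⁻¹` with internal indices, every invertible quadratic form `Q` whose covariance is
`(Q⁻¹)_{uv} = λ^a · Re(𝓕φ^{idx u, idx v})(λ(pos u − pos v))` (read through `ℝ^d ≅ (Fin d → ℝ)`), and every `2n` ghost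
fields: `|⟨∏ₐ ψ̄_{iₐ}ψ_{jₐ}⟩_Q| · ∏_Δ (n_Δ!)^r (n̄_Δ!)^r ≤ K^n` — CMP 155 p.354 tl.13–15 with the printed quantifiers of
[R] Lemma III.4.1, the (III.4.8)-type bounds being DERIVED (`ScaledKernel.exists_profile_bound_re_fourier`), not
assumed. [cite: MagnenRivasseauSeneor1993, p.354 tl.13–15] [cite: Rivasseau1991, §III.4 Lemma III.4.1 (III.4.6)–(III.4.9), p.245] -/
theorem exists_const_wick_bound_of_schwartz_cutoff {A : Type*} [Fintype A] (d r : ℕ) (hd : 1 ≤ d)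
    (φ : A → A → SchwartzMap (EuclideanSpace ℝ (Fin d)) ℂ) {lam : ℝ} (hlam : 0 < lam) (a : ℝ) :
    ∃ K : ℝ, ∀ {κ : Type} [LinearOrder κ] [Fintype κ] (Λ : Finset (Fin d → ℤ)) (pos : κ → Fin d → ℝ)
      (cube : κ → Fin d → ℤ) (idx : κ → A), (∀ u, cube u ∈ Λ) →
      (∀ u μ, pos u μ ∈ Icc (lam⁻¹ * (cube u μ : ℝ)) (lam⁻¹ * (cube u μ : ℝ) + lam⁻¹)) →
      ∀ (Q : Matrix κ κ ℝ), Q.det ≠ 0 →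
      (∀ u v, Q⁻¹ u v = lam ^ a *
        ((𝓕 (φ (idx u) (idx v) : EuclideanSpace ℝ (Fin d) → ℂ))
          ((EuclideanSpace.equiv (Fin d) ℝ).symm (lam • (pos u - pos v)))).re) →
      ∀ {n : ℕ} (i j : Fin n → κ),
        |berezin ℝ (κ ⊕ₗ κ) (grassmannExp (quadratic ℝ Q) *
              (List.ofFn fun a => psiBar ℝ (i a) * psi ℝ (j a)).prod) /
            berezin ℝ (κ ⊕ₗ κ) (grassmannExp (quadratic ℝ Q))| *
          ∏ Δ ∈ Λ, ((((univ.filter fun a : Fin n => cube (j a) = Δ).card.factorial : ℕ) : ℝ) ^ r *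
            (((univ.filter fun b : Fin n => cube (i b) = Δ).card.factorial : ℕ) : ℝ) ^ r) ≤ K ^ n := by
  classical
  -- profiles F^{αβ} = Re(𝓕φ^{αβ}) ∘ e⁻¹ and a uniform bound B over the finitely many (α, β)
  set p : ℕ := 2 * d * (2 * r + 1) with hp
  have hprof := fun α β => exists_profile_bound_re_fourier (φ α β) p (d + 1)
  choose B hB0 hB using hprof
  set Bt : ℝ := ∑ α, ∑ β, B α β with hBt
  have hBle : ∀ α β, B α β ≤ Bt := by
    intro α β
    calc B α β ≤ ∑ β', B α β' := Finset.single_le_sum (f := fun β' => B α β') (fun β' _ => hB0 α β')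
          (Finset.mem_univ β)
      _ ≤ ∑ α', ∑ β', B α' β' := Finset.single_le_sum (f := fun α' => ∑ β', B α' β')
          (fun α' _ => Finset.sum_nonneg fun β' _ => hB0 α' β') (Finset.mem_univ α)
  have hBt0 : 0 ≤ Bt := Finset.sum_nonneg fun α _ => Finset.sum_nonneg fun β _ => hB0 α β
  have hs : (d : ℝ) < ((d + 1 : ℕ) : ℝ) := by exact_mod_cast Nat.lt_succ_self d
  set F : A → A → (Fin d → ℝ) → ℝ := fun α β x =>
    ((𝓕 (φ α β : EuclideanSpace ℝ (Fin d) → ℂ)) ((EuclideanSpace.equiv (Fin d) ℝ).symm x)).re with hFdef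
  have hFc : ∀ α β, ContDiff ℝ p (F α β) := by
    intro α β
    have h1 : ContDiff ℝ p (fun x : Fin d → ℝ =>
        (𝓕 (φ α β) : SchwartzMap (EuclideanSpace ℝ (Fin d)) ℂ) ((EuclideanSpace.equiv (Fin d) ℝ).symm x)) :=
      ((𝓕 (φ α β) : SchwartzMap (EuclideanSpace ℝ (Fin d)) ℂ).smooth p).comp
        (EuclideanSpace.equiv (Fin d) ℝ).symm.contDiff
    exact Complex.reCLM.contDiff.comp h1
  have hFB : ∀ α β (m : ℕ), m ≤ p → ∀ w, ‖iteratedFDeriv ℝ m (F α β) w‖ ≤ Bt * (1 + ‖w‖) ^ (-((d + 1 : ℕ) : ℝ)) := by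
    intro α β m hm w
    exact (hB α β m hm w).trans (mul_le_mul_of_nonneg_right (hBle α β) (Real.rpow_nonneg (by positivity) _))
  refine ⟨4 * (2 * d * (2 * r + 1)) * ((2 : ℝ) ^ ((d + 1 : ℕ) : ℝ) * Bt * lam ^ a) * (2 * T1 (((d + 1 : ℕ) : ℝ) / d)) ^ d *
      (2 ^ (d + 1) * (Fintype.card A * ∑ m ∈ Finset.range (2 * d * (2 * r + 1)), (d : ℝ) ^ m)) ^ (2 * r + 1), ?_⟩
  intro κ _ _ Λ pos cube idx hcube hpos Q hQ hG n i j
  exact abs_wick_mul_prod_factorial_pow_le_of_profile d r hd hs hlam hBt0 a Λ pos cube idx hcube hpos F hFc hFB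
    Q hQ (fun u v => by rw [hG u v]) i j

end GhostDeterminant

end Literature.MathematicalPhysics.QuantumFieldTheory.MagnenRivasseauSeneor1993
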